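import Summits.CriticalPhenomena.PercolationContinuityZ3.Theorems.PercNearOneGluingNoHeavyLowerTailFKCSHPhiMonotoneDefs
import HarnessLib

/-!
# FK sub-lane: TOOLS for the lockstep exploration — support, one-point decomposition, lockstep arithmetic

Support file (`--supports stmt-CriticalPhenomena-4575`), FK sub-lane `prim-bschramm-fk-1` (gen 3); builds on p205010 (kernel theorem,
internal audit signed; external expert review pending).  No definitions, no named facts, no sorries; standard axioms.

* `FK.mem_of_rcMass_ne_zero` — parameter-1 pairs are open and parameter-0 pairs are closed on the support of `φ_v`;
* `FK.rcE_congr_support`, `FK.rcE_one`, `FK.rcE_const_mul_sub`, `FK.rcE_mono_weights` (comparison in `𝐩`, `q ≥ 1`);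
* `FK.popen_nonneg/le_one/mono/eq_one/eq_zero`;
* `FK.rcE_opd` — ONE-POINT DECOMPOSITION `E_v h = φ_v(f)·E_{v[f↦1]} h + (1−φ_v(f))·E_{v[f↦0]} h` (Grimmett's Thm (3.7) for one pair, from the
  tree's `rcWeightW_mul_ind_cylinder`);
* `FK.lockstep2`, `FK.lockstep3` — two / three revealed bits with ordered probabilities coupled through one uniform variable, written as a
  nonnegative combination of the reachable bit patterns.
[cite: Grimmett2006, Thm. (3.7) (p. 39); Thm. (3.1)(a) (p. 37); Thm. (3.21) (p. 44); §1.4 eq. (1.20) (p. 15)]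
-/

noncomputable section

namespace Summit.CriticalPhenomena.PercolationContinuityZ3.Theorems

open MeasureTheory Set Literature.Probability.LatticeModels Literature.Probability.Percolation
open scoped Classical
open BHK2006 DecisionTree HullPort

namespace FK

variable {V : Type*} [Fintype V]

/-- **Support lemma.** If `φ_v(ω) ≠ 0` then every parameter-`1` pair is open in `ω` and every parameter-`0` pair is closed.
[cite: Grimmett2006, §1.4 eq. (1.20) (p. 15)] -/
theorem mem_of_rcMass_ne_zero (v : Sym2 V → unitInterval) (q : ℝ) {ω : BondConfig V} (hω : rcMass v q ω ≠ 0) :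
    (∀ f, v f = 1 → f ∈ ω) ∧ (∀ f, v f = 0 → f ∉ ω) := by
  have key : ∀ f, ((f ∉ ω ∧ v f = 1) ∨ (f ∈ ω ∧ v f = 0)) → rcMass v q ω = 0 := by
    intro f hf
    have hzero : weight (fun e => ((v e : unitInterval) : ℝ)) ω = 0 := by
      unfold weight
      refine Finset.prod_eq_zero (Finset.mem_univ f) ?_
      rcases hf with ⟨hfω, h1⟩ | ⟨hfω, h0⟩
      · rw [if_neg hfω]; simp [h1]
      · rw [if_pos hfω]; simp [h0]
    unfold rcMass rcWeightW
    rw [hzero, zero_mul, zero_div]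
  refine ⟨fun f hf => ?_, fun f hf hfω => hω (key f (Or.inr ⟨hfω, hf⟩))⟩
  by_contra hfω
  exact hω (key f (Or.inl ⟨hfω, hf⟩))

/-- Expectations only see the support: if `h = h'` wherever `φ_v(ω) ≠ 0` then `E_v h = E_v h'`. [folklore] -/
theorem rcE_congr_support (v : Sym2 V → unitInterval) (q : ℝ) {h h' : BondConfig V → ℝ}
    (H : ∀ ω, rcMass v q ω ≠ 0 → h ω = h' ω) : rcE v q h = rcE v q h' := by
  unfold rcE
  refine Finset.sum_congr rfl fun ω _ => ?_
  by_cases hω : rcMass v q ω = 0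
  · rw [hω, zero_mul, zero_mul]
  · rw [H ω hω]

/-- `E_v[1] = 1` (`q > 0`). [cite: Grimmett2006, §1.4 eq. (1.20) (p. 15)] -/
theorem rcE_one (v : Sym2 V → unitInterval) {q : ℝ} (hq : 0 < q) : rcE v q (fun _ => 1) = 1 := by
  unfold rcE; simp only [mul_one]; exact sum_rcMass v hq

/-- `E_v[c·h₁ - h₂]`-type linearity: `E_v[a·(c - h)] = a·(c - E_v h)`. [folklore] -/
theorem rcE_const_mul_sub (v : Sym2 V → unitInterval) {q : ℝ} (hq : 0 < q) (a c : ℝ) (h : BondConfig V → ℝ) :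
    rcE v q (fun ω => a * (c - h ω)) = a * (c - rcE v q h) := by
  unfold rcE
  have e1 : ∀ ω, rcMass v q ω * (a * (c - h ω)) = a * c * rcMass v q ω - a * (rcMass v q ω * h ω) := fun ω => by ring
  simp only [e1, Finset.sum_sub_distrib, ← Finset.mul_sum, sum_rcMass v hq]
  ring

/-- `E_v` is monotone in the parameters on increasing functions (`q ≥ 1`; comparison in `𝐩`).
[cite: Grimmett2006, Thm. (3.21) (p. 44)] -/
theorem rcE_mono_weights {v v' : Sym2 V → unitInterval} (hvv : ∀ e, v e ≤ v' e) {q : ℝ} (hq : 1 ≤ q)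
    {h : BondConfig V → ℝ} (hh : Monotone h) : rcE v q h ≤ rcE v' q h :=
  sum_rcMass_mono_weights hvv hq hh

/-- `0 ≤ φ_v(f open) ≤ 1`. [cite: Grimmett2006, Thm. (3.1)(a) (p. 37)] -/
theorem popen_nonneg (v : Sym2 V → unitInterval) {q : ℝ} (hq : 0 < q) (f : Sym2 V) : 0 ≤ popen v q f :=
  Finset.sum_nonneg fun ω _ => mul_nonneg (rcMass_nonneg v hq ω) (ind_nonneg _ _)

/-- `φ_v(f open) ≤ 1`. [cite: Grimmett2006, Thm. (3.1)(a) (p. 37)] -/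
theorem popen_le_one (v : Sym2 V → unitInterval) {q : ℝ} (hq : 0 < q) (f : Sym2 V) : popen v q f ≤ 1 := by
  unfold popen rcE
  calc ∑ ω, rcMass v q ω * ind {ω : BondConfig V | f ∈ ω} ω ≤ ∑ ω, rcMass v q ω * 1 :=
        Finset.sum_le_sum fun ω _ => mul_le_mul_of_nonneg_left (by unfold ind; split_ifs <;> norm_num) (rcMass_nonneg v hq ω)
    _ = 1 := by simp only [mul_one]; exact sum_rcMass v hq

/-- `φ_v(f open)` is monotone in the parameters (`q ≥ 1`). [cite: Grimmett2006, Thm. (3.21) (p. 44)] -/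
theorem popen_mono {v v' : Sym2 V → unitInterval} (hvv : ∀ e, v e ≤ v' e) {q : ℝ} (hq : 1 ≤ q) (f : Sym2 V) :
    popen v q f ≤ popen v' q f :=
  rcE_mono_weights hvv hq fun ω ω' hle => by
    unfold ind
    by_cases h : f ∈ ω
    · rw [if_pos (show ω ∈ {ω : BondConfig V | f ∈ ω} from h), if_pos (show ω' ∈ {ω : BondConfig V | f ∈ ω} from hle h)]
    · rw [if_neg (show ω ∉ {ω : BondConfig V | f ∈ ω} from h)]; split_ifs <;> norm_num

/-- A parameter-`1` pair is surely open: `φ_v(f open) = 1`. [cite: Grimmett2006, §1.4 eq. (1.20) (p. 15)] -/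
theorem popen_eq_one {v : Sym2 V → unitInterval} {q : ℝ} (hq : 0 < q) {f : Sym2 V} (hf : v f = 1) : popen v q f = 1 := by
  unfold popen
  rw [← rcE_one v hq]
  refine rcE_congr_support v q fun ω hω => ?_
  exact ind_of_mem (show ω ∈ {ω : BondConfig V | f ∈ ω} from (mem_of_rcMass_ne_zero v q hω).1 f hf)

/-- A parameter-`0` pair is surely closed: `φ_v(f open) = 0`. [cite: Grimmett2006, §1.4 eq. (1.20) (p. 15)] -/
theorem popen_eq_zero {v : Sym2 V → unitInterval} {q : ℝ} {f : Sym2 V} (hf : v f = 0) : popen v q f = 0 := by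
  unfold popen
  have : rcE v q (fun _ => (0 : ℝ)) = 0 := by unfold rcE; simp
  rw [← this]
  refine rcE_congr_support v q fun ω hω => ?_
  exact ind_of_not_mem (show ω ∉ {ω : BondConfig V | f ∈ ω} from (mem_of_rcMass_ne_zero v q hω).2 f hf)

omit [Fintype V] in
/-- The conditional parameter vector for the single pair `f`, state open, is `v[f ↦ 1]`. [cite: Grimmett2006, Thm. (3.7) (p. 39)] -/
theorem condWeights_single_true (v : Sym2 V → unitInterval) (f : Sym2 V) :
    condWeights v {e | e ≠ f} {f} = setW v f true := by
  funext e
  by_cases h : e = f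
  · subst h; simp [condWeights, setW]
  · simp [condWeights, setW, h]

omit [Fintype V] in
/-- The conditional parameter vector for the single pair `f`, state closed, is `v[f ↦ 0]`. [cite: Grimmett2006, Thm. (3.7) (p. 39)] -/
theorem condWeights_single_false (v : Sym2 V → unitInterval) (f : Sym2 V) :
    condWeights v {e | e ≠ f} ∅ = setW v f false := by
  funext e
  by_cases h : e = f
  · subst h; simp [condWeights, setW]
  · simp [condWeights, setW, h]

omit [Fintype V] in
/-- The cylinder `{ω ∖ {e ≠ f} = {f}}` is `{f open}`. [folklore] -/
theorem cylinder_single_true (f : Sym2 V) :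
    {ω : BondConfig V | ω \ {e | e ≠ f} = {f}} = {ω : BondConfig V | f ∈ ω} := by
  ext ω
  simp only [mem_setOf_eq]
  constructor
  · intro h
    have : f ∈ ω \ {e | e ≠ f} := by rw [h]; exact mem_singleton f
    exact this.1
  · intro h
    ext e
    simp only [mem_sdiff, mem_setOf_eq, not_not, mem_singleton_iff]
    constructor
    · rintro ⟨-, rfl⟩; rfl
    · rintro rfl; exact ⟨h, rfl⟩

omit [Fintype V] in
/-- The cylinder `{ω ∖ {e ≠ f} = ∅}` is `{f closed}`. [folklore] -/
theorem cylinder_single_false (f : Sym2 V) :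
    {ω : BondConfig V | ω \ {e | e ≠ f} = ∅} = {ω : BondConfig V | f ∉ ω} := by
  ext ω
  simp only [mem_setOf_eq]
  constructor
  · intro h hf
    have : f ∈ ω \ {e | e ≠ f} := ⟨hf, fun h' => h' rfl⟩
    rw [h] at this
    exact this
  · intro h
    ext e
    simp only [mem_sdiff, mem_setOf_eq, not_not, mem_empty_iff_false, iff_false, not_and]
    rintro he rfl
    exact h he

/-- **Pointwise one-point decomposition, open branch**: `φ_v(ω)·1{f ∈ ω} = φ_v(f open)·φ_{v[f↦1]}(ω)`.
[cite: Grimmett2006, Thm. (3.7) (p. 39)] -/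
theorem rcMass_mul_ind_open (v : Sym2 V → unitInterval) {q : ℝ} (hq : 0 < q) (f : Sym2 V) (ω : BondConfig V) :
    rcMass v q ω * ind {ω : BondConfig V | f ∈ ω} ω = popen v q f * rcMass (setW v f true) q ω := by
  have hdisj : Disjoint ({f} : Set (Sym2 V)) {e | e ≠ f} := by
    rw [Set.disjoint_left]; intro e he h; rw [mem_singleton_iff] at he; exact h he
  have key := fun η => rcWeightW_mul_ind_cylinder v q (∅ : Set V) hdisj η
  simp only [cylinder_single_true, condWeights_single_true] at key
  set c := offWeight v {e | e ≠ f} {f} with hc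
  set v1 := setW v f true with hv1
  have hZ := rcPartitionFunctionW_pos v hq (∅ : Set V)
  have hZ1 := rcPartitionFunctionW_pos v1 hq (∅ : Set V)
  -- the open-pair probability is `c · Z(v1) / Z(v)`
  have hp : popen v q f * rcPartitionFunctionW v q ∅ = c * rcPartitionFunctionW v1 q ∅ := by
    unfold popen rcE
    rw [Finset.sum_mul]
    have e1 : ∀ η, rcMass v q η * ind {ω : BondConfig V | f ∈ ω} η * rcPartitionFunctionW v q ∅ =
        c * rcWeightW v1 q ∅ η := by
      intro η
      rw [← key η]
      unfold rcMass
      field_simp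
    simp only [e1, ← Finset.mul_sum]
    rfl
  have hp' : popen v q f = c * rcPartitionFunctionW v1 q ∅ / rcPartitionFunctionW v q ∅ := by
    rw [eq_div_iff hZ.ne']; exact hp
  rw [hp']
  unfold rcMass
  rw [div_mul_eq_mul_div, key ω]
  field_simp

/-- **Pointwise one-point decomposition, closed branch**: `φ_v(ω)·1{f ∉ ω} = φ_v(f closed)·φ_{v[f↦0]}(ω)`.
[cite: Grimmett2006, Thm. (3.7) (p. 39)] -/
theorem rcMass_mul_ind_closed (v : Sym2 V → unitInterval) {q : ℝ} (hq : 0 < q) (f : Sym2 V) (ω : BondConfig V) :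
    rcMass v q ω * ind {ω : BondConfig V | f ∉ ω} ω =
      rcE v q (ind {ω : BondConfig V | f ∉ ω}) * rcMass (setW v f false) q ω := by
  have hdisj : Disjoint (∅ : Set (Sym2 V)) {e | e ≠ f} := Set.empty_disjoint _
  have key := fun η => rcWeightW_mul_ind_cylinder v q (∅ : Set V) hdisj η
  simp only [cylinder_single_false, condWeights_single_false] at key
  set c := offWeight v {e | e ≠ f} ∅ with hc
  set v0 := setW v f false with hv0
  have hZ := rcPartitionFunctionW_pos v hq (∅ : Set V)
  have hZ0 := rcPartitionFunctionW_pos v0 hq (∅ : Set V)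
  have hp : rcE v q (ind {ω : BondConfig V | f ∉ ω}) * rcPartitionFunctionW v q ∅ = c * rcPartitionFunctionW v0 q ∅ := by
    unfold rcE
    rw [Finset.sum_mul]
    have e1 : ∀ η, rcMass v q η * ind {ω : BondConfig V | f ∉ ω} η * rcPartitionFunctionW v q ∅ =
        c * rcWeightW v0 q ∅ η := by
      intro η
      rw [← key η]
      unfold rcMass
      field_simp
    simp only [e1, ← Finset.mul_sum]
    rfl
  have hp' : rcE v q (ind {ω : BondConfig V | f ∉ ω}) = c * rcPartitionFunctionW v0 q ∅ / rcPartitionFunctionW v q ∅ := by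
    rw [eq_div_iff hZ.ne']; exact hp
  rw [hp']
  unfold rcMass
  rw [div_mul_eq_mul_div, key ω]
  field_simp

/-- `φ_v(f closed) = 1 − φ_v(f open)`. [cite: Grimmett2006, Thm. (3.1)(a) (p. 37)] -/
theorem rcE_ind_closed (v : Sym2 V → unitInterval) {q : ℝ} (hq : 0 < q) (f : Sym2 V) :
    rcE v q (ind {ω : BondConfig V | f ∉ ω}) = 1 - popen v q f := by
  unfold popen rcE
  rw [← sum_rcMass v hq, ← Finset.sum_sub_distrib]
  refine Finset.sum_congr rfl fun ω _ => ?_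
  by_cases h : f ∈ ω
  · rw [ind_of_mem (show ω ∈ {ω : BondConfig V | f ∈ ω} from h),
      ind_of_not_mem (show ω ∉ {ω : BondConfig V | f ∉ ω} from fun h' => h' h)]; ring
  · rw [ind_of_not_mem (show ω ∉ {ω : BondConfig V | f ∈ ω} from h),
      ind_of_mem (show ω ∈ {ω : BondConfig V | f ∉ ω} from h)]; ring

/-- **ONE-POINT DECOMPOSITION** of an expectation along the state of the pair `f`:
`E_v h = φ_v(f open)·E_{v[f↦1]} h + (1 − φ_v(f open))·E_{v[f↦0]} h`. [cite: Grimmett2006, Thm. (3.7) (p. 39)] -/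
theorem rcE_opd (v : Sym2 V → unitInterval) {q : ℝ} (hq : 0 < q) (f : Sym2 V) (h : BondConfig V → ℝ) :
    rcE v q h = popen v q f * rcE (setW v f true) q h + (1 - popen v q f) * rcE (setW v f false) q h := by
  rw [← rcE_ind_closed v hq f]
  unfold rcE
  rw [Finset.mul_sum, Finset.mul_sum, ← Finset.sum_add_distrib]
  refine Finset.sum_congr rfl fun ω _ => ?_
  have hsplit : rcMass v q ω = rcMass v q ω * ind {ω : BondConfig V | f ∈ ω} ω + rcMass v q ω * ind {ω : BondConfig V | f ∉ ω} ω := by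
    by_cases hf : f ∈ ω
    · rw [ind_of_mem (show ω ∈ {ω : BondConfig V | f ∈ ω} from hf),
        ind_of_not_mem (show ω ∉ {ω : BondConfig V | f ∉ ω} from fun h' => h' hf)]; ring
    · rw [ind_of_not_mem (show ω ∉ {ω : BondConfig V | f ∈ ω} from hf),
        ind_of_mem (show ω ∈ {ω : BondConfig V | f ∉ ω} from hf)]; ring
  rw [hsplit, add_mul, rcMass_mul_ind_open v hq f ω, rcMass_mul_ind_closed v hq f ω]
  unfold rcE
  ring

/-- **Lockstep for two bits** (`p₁ ≤ p₂`): `(p₁B₁ + (1−p₁)B₀) − (p₂C₁ + (1−p₂)C₀) = p₁(B₁−C₁) + (p₂−p₁)(B₀−C₁) + (1−p₂)(B₀−C₀)`,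
so it is nonnegative as soon as each bracket with a positive coefficient is. [folklore] -/
theorem lockstep2 {p₁ p₂ B₁ B₀ C₁ C₀ : ℝ} (h0 : 0 ≤ p₁) (h12 : p₁ ≤ p₂) (h2 : p₂ ≤ 1)
    (F11 : 0 < p₁ → 0 ≤ B₁ - C₁) (F01 : p₁ < p₂ → 0 ≤ B₀ - C₁) (F00 : p₂ < 1 → 0 ≤ B₀ - C₀) :
    0 ≤ (p₁ * B₁ + (1 - p₁) * B₀) - (p₂ * C₁ + (1 - p₂) * C₀) := by
  have t1 : 0 ≤ p₁ * (B₁ - C₁) := by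
    rcases eq_or_lt_of_le h0 with h | h
    · rw [← h]; simp
    · exact mul_nonneg h0 (F11 h)
  have t2 : 0 ≤ (p₂ - p₁) * (B₀ - C₁) := by
    rcases eq_or_lt_of_le h12 with h | h
    · rw [h]; simp
    · exact mul_nonneg (by linarith) (F01 h)
  have t3 : 0 ≤ (1 - p₂) * (B₀ - C₀) := by
    rcases eq_or_lt_of_le h2 with h | h
    · rw [h]; simp
    · exact mul_nonneg (by linarith) (F00 h)
  nlinarith [t1, t2, t3]

/-- **Lockstep for three bits** (`p₁ ≤ p₂`, `p₁ ≤ p₃`; bits `b₁ ≤ b₂`, `b₁ ≤ b₃`):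
`(p₃Z₁ + (1−p₃)Z₀) − (p₁B₁ + (1−p₁)B₀) − (p₂C₁ + (1−p₂)C₀)` is a nonnegative combination of the brackets
`Z_{b₃} − B_{b₁} − C_{b₂}` over the reachable bit patterns, hence nonnegative when those brackets are. [folklore] -/
theorem lockstep3 {p₁ p₂ p₃ Z₁ Z₀ B₁ B₀ C₁ C₀ : ℝ} (h0 : 0 ≤ p₁) (h12 : p₁ ≤ p₂) (h13 : p₁ ≤ p₃) (h2 : p₂ ≤ 1) (h3 : p₃ ≤ 1)
    (F111 : 0 < p₁ → 0 ≤ Z₁ - B₁ - C₁) (F011 : p₁ < p₂ → p₁ < p₃ → 0 ≤ Z₁ - B₀ - C₁)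
    (F010 : p₃ < p₂ → 0 ≤ Z₀ - B₀ - C₁) (F001 : p₂ < p₃ → 0 ≤ Z₁ - B₀ - C₀) (F000 : p₂ < 1 → p₃ < 1 → 0 ≤ Z₀ - B₀ - C₀) :
    0 ≤ (p₃ * Z₁ + (1 - p₃) * Z₀) - (p₁ * B₁ + (1 - p₁) * B₀) - (p₂ * C₁ + (1 - p₂) * C₀) := by
  have t1 : 0 ≤ p₁ * (Z₁ - B₁ - C₁) := by
    rcases eq_or_lt_of_le h0 with h | h
    · rw [← h]; simp
    · exact mul_nonneg h0 (F111 h)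
  rcases le_total p₂ p₃ with h23 | h32
  · -- order p₁ ≤ p₂ ≤ p₃
    have t2 : 0 ≤ (p₂ - p₁) * (Z₁ - B₀ - C₁) := by
      rcases eq_or_lt_of_le h12 with h | h
      · rw [h]; simp
      · exact mul_nonneg (by linarith) (F011 h (lt_of_lt_of_le h h23))
    have t3 : 0 ≤ (p₃ - p₂) * (Z₁ - B₀ - C₀) := by
      rcases eq_or_lt_of_le h23 with h | h
      · rw [h]; simp
      · exact mul_nonneg (by linarith) (F001 h)
    have t4 : 0 ≤ (1 - p₃) * (Z₀ - B₀ - C₀) := by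
      rcases eq_or_lt_of_le h3 with h | h
      · rw [h]; simp
      · exact mul_nonneg (by linarith) (F000 (lt_of_le_of_lt h23 h) h)
    nlinarith [t1, t2, t3, t4]
  · -- order p₁ ≤ p₃ ≤ p₂
    have t2 : 0 ≤ (p₃ - p₁) * (Z₁ - B₀ - C₁) := by
      rcases eq_or_lt_of_le h13 with h | h
      · rw [h]; simp
      · exact mul_nonneg (by linarith) (F011 (lt_of_lt_of_le h h32) h)
    have t3 : 0 ≤ (p₂ - p₃) * (Z₀ - B₀ - C₁) := by
      rcases eq_or_lt_of_le h32 with h | h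
      · rw [h]; simp
      · exact mul_nonneg (by linarith) (F010 h)
    have t4 : 0 ≤ (1 - p₂) * (Z₀ - B₀ - C₀) := by
      rcases eq_or_lt_of_le h2 with h | h
      · rw [h]; simp
      · exact mul_nonneg (by linarith) (F000 h (lt_of_le_of_lt h32 h))
    nlinarith [t1, t2, t3, t4]

end FK

end Summit.CriticalPhenomena.PercolationContinuityZ3.Theorems

end
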